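import Literature.NumberTheory.Sieve.ShiuTheoremProofs
import HarnessLib

/-!
# The bivariate Shiu decomposition: arithmetic of `n ↦ (n, mn + h)`

Topic `Literature/NumberTheory/Sieve`. Everything here is PROVED; no definition is introduced.
Elementary tools for the Shiu–Nair–Tenenbaum treatment of `∑_{n ≤ X} f(n) g(mn + h)`
(Matomäki–Merikoski, arXiv:2112.11412, Lemma 3.1): multiplicativity of the smooth part,
`gcd(n, mn + h) = gcd(n, h)` and its consequences for the `p`-adic valuations at the primes of `h`,
the `h`-part `∏_{p ∣ h} p^{v_p(n)}` of an integer and its basic properties, Rankin-type counts of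
integers with a large `h`-part, and counts of multiples in `[1, N]` and along `n ↦ mn + h`.

## References

* K. Matomäki, J. Merikoski, IMRN 2023 (arXiv:2112.11412), Lemma 3.1. [cite: MatomakiMerikoski2023, Lemma 3.1]
* P. Shiu, J. reine angew. Math. 313 (1980), 161–170, §5. [cite: Shiu1980, §5]
-/

noncomputable section

open Finset Real

namespace Literature.NumberTheory.Sieve

namespace PairShiu

/-! ### The smooth part is multiplicative -/

/-- `smoothPart B (ab) = smoothPart B a · smoothPart B b` for `a, b ≠ 0`. [folklore] -/
theorem smoothPart_mul {a b : ℕ} (ha : a ≠ 0) (hb : b ≠ 0) (B : ℕ) :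
    smoothPart B (a * b) = smoothPart B a * smoothPart B b := by
  refine Nat.eq_of_factorization_eq (smoothPart_ne_zero _ _)
    (mul_ne_zero (smoothPart_ne_zero _ _) (smoothPart_ne_zero _ _)) fun p => ?_
  rw [Nat.factorization_mul (smoothPart_ne_zero _ _) (smoothPart_ne_zero _ _), Finsupp.add_apply,
    factorization_smoothPart, factorization_smoothPart, factorization_smoothPart,
    Nat.factorization_mul ha hb, Finsupp.add_apply]
  split_ifs <;> rfl

/-- The valuations of the rough cofactor: `v_p(n / smoothPart B n) = [B ≤ p] v_p(n)`. [folklore] -/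
theorem factorization_div_smoothPart {n : ℕ} (hn : n ≠ 0) (B p : ℕ) :
    (n / smoothPart B n).factorization p = if p < B then 0 else n.factorization p := by
  rw [Nat.factorization_div (smoothPart_dvd hn B), Finsupp.tsub_apply, factorization_smoothPart]
  split_ifs <;> omega

/-! ### `gcd(n, mn + h) = gcd(n, h)` and valuations at the primes of `h`

(`gcd(n, mn + h) = gcd(n, h)` itself is core's `Nat.gcd_mul_right_add_right n h m`.) -/

/-- **The coupling of the valuations.** For every prime `p` and `n ≥ 1`:
`min(v_p(n), v_p(mn+h)) = min(v_p(n), v_p(h))`. [folklore] -/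
theorem min_factorization_lin {n : ℕ} (hn : n ≠ 0) {h : ℕ} (hh : h ≠ 0) (m p : ℕ) :
    min (n.factorization p) ((m * n + h).factorization p) =
      min (n.factorization p) (h.factorization p) := by
  have h1 : (Nat.gcd n (m * n + h)).factorization p = min (n.factorization p) ((m * n + h).factorization p) := by
    rw [Nat.factorization_gcd hn (by omega), Finsupp.inf_apply]
  have h2 : (Nat.gcd n h).factorization p = min (n.factorization p) (h.factorization p) := by
    rw [Nat.factorization_gcd hn hh, Finsupp.inf_apply]
  rw [← h1, ← h2, Nat.gcd_mul_right_add_right]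

/-- At a prime `p ∣ h` with `p ∤ m`: `p ∣ n ↔ p ∣ mn + h`. [folklore] -/
theorem dvd_iff_dvd_lin {p m h : ℕ} (hp : p.Prime) (hph : p ∣ h) (hpm : ¬ p ∣ m) (n : ℕ) :
    p ∣ n ↔ p ∣ m * n + h := by
  constructor
  · intro hn
    exact dvd_add (dvd_mul_of_dvd_right hn _) hph
  · intro hL
    have : p ∣ m * n := (Nat.dvd_add_left hph).mp hL
    exact ((Nat.Prime.dvd_mul hp).mp this).resolve_left hpm

/-- At a prime `p ∣ h` with `p ∤ m`, `n ≥ 1`: `v_p(n) = 0 ↔ v_p(mn + h) = 0`. [folklore] -/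
theorem factorization_eq_zero_iff_lin {p m h : ℕ} (hp : p.Prime) (hph : p ∣ h) (hpm : ¬ p ∣ m)
    {n : ℕ} (hn : n ≠ 0) : n.factorization p = 0 ↔ (m * n + h).factorization p = 0 := by
  -- (if `h = 0` the statement reads `v_p(n) = 0 ↔ v_p(mn) = 0`, true as `p ∤ m`)
  rcases Nat.eq_zero_or_pos (m * n + h) with hL0 | hLpos
  · have hh0 : h = 0 := by omega
    have hmn : m * n = 0 := by omega
    rcases Nat.mul_eq_zero.mp hmn with hm0 | hn0
    · exact absurd (hm0 ▸ dvd_zero p) hpm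
    · exact absurd hn0 hn
  have hL : m * n + h ≠ 0 := by omega
  rw [Nat.factorization_eq_zero_iff, Nat.factorization_eq_zero_iff]
  simp only [hp, not_true_eq_false, false_or, hn, hL, or_false]
  exact (dvd_iff_dvd_lin hp hph hpm n).not

/-- For `p ∤ h`: `p` divides at most one of `n` and `mn + h`, so
`v_p(n (mn+h)) ≥ e` forces `p^e ∣ n` or `p^e ∣ mn + h` (`n ≥ 1`). [folklore] -/
theorem pow_dvd_or_of_not_dvd {p m h n e : ℕ} (hp : p.Prime) (hph : ¬ p ∣ h) (hn : n ≠ 0)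
    (he : e ≤ (n * (m * n + h)).factorization p) : p ^ e ∣ n ∨ p ^ e ∣ m * n + h := by
  have hh : h ≠ 0 := fun h0 => hph (h0 ▸ dvd_zero p)
  have hL : m * n + h ≠ 0 := by omega
  rw [Nat.factorization_mul hn hL, Finsupp.add_apply] at he
  by_cases hpn : p ∣ n
  · -- then `p ∤ mn + h`
    have hpL : ¬ p ∣ m * n + h := by
      intro h'
      exact hph ((Nat.dvd_add_right (dvd_mul_of_dvd_right hpn m)).mp h')
    rw [Nat.factorization_eq_zero_of_not_dvd hpL, add_zero] at he
    left
    exact (hp.pow_dvd_iff_le_factorization hn).mpr he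
  · rw [Nat.factorization_eq_zero_of_not_dvd hpn, zero_add] at he
    right
    exact (hp.pow_dvd_iff_le_factorization hL).mpr he

/-- For any prime: `v_p(n (mn+h)) ≥ e` forces `p^{⌈e/2⌉} ∣ n` or `p^{⌈e/2⌉} ∣ mn + h`
(`n, h ≥ 1`). [folklore] -/
theorem pow_half_dvd_or {p m h n e : ℕ} (hp : p.Prime) (hh : h ≠ 0) (hn : n ≠ 0)
    (he : e ≤ (n * (m * n + h)).factorization p) :
    p ^ ((e + 1) / 2) ∣ n ∨ p ^ ((e + 1) / 2) ∣ m * n + h := by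
  have hL : m * n + h ≠ 0 := by omega
  rw [Nat.factorization_mul hn hL, Finsupp.add_apply] at he
  by_cases h1 : (e + 1) / 2 ≤ n.factorization p
  · left; exact (hp.pow_dvd_iff_le_factorization hn).mpr h1
  · right
    refine (hp.pow_dvd_iff_le_factorization hL).mpr ?_
    omega

/-! ### The `h`-part of an integer -/

/-- The valuations of the `h`-part `∏_{p ∣ h} p^{v_p(n)}`. [folklore] -/
theorem factorization_hPart (h n p : ℕ) :
    (∏ q ∈ h.primeFactors, q ^ n.factorization q).factorization p =
      if p ∈ h.primeFactors then n.factorization p else 0 := by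
  rw [Nat.factorization_prod fun q hq => pow_ne_zero _ (Nat.prime_of_mem_primeFactors hq).ne_zero]
  rw [Finsupp.finsetSum_apply]
  have : ∀ q ∈ h.primeFactors, (q ^ n.factorization q).factorization p =
      if q = p then n.factorization p else 0 := by
    intro q hq
    rw [(Nat.prime_of_mem_primeFactors hq).factorization_pow, Finsupp.single_apply]
    split_ifs with h1
    · subst h1; rfl
    · rfl
  rw [Finset.sum_congr rfl this, Finset.sum_ite_eq']

/-- The `h`-part is non-zero. [folklore] -/
theorem hPart_ne_zero (h n : ℕ) : ∏ q ∈ h.primeFactors, q ^ n.factorization q ≠ 0 :=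
  Finset.prod_ne_zero_iff.mpr fun _ hq => pow_ne_zero _ (Nat.prime_of_mem_primeFactors hq).ne_zero

/-- The `h`-part divides `n` (`n ≠ 0`). [folklore] -/
theorem hPart_dvd {n : ℕ} (hn : n ≠ 0) (h : ℕ) : ∏ q ∈ h.primeFactors, q ^ n.factorization q ∣ n := by
  rw [← Nat.factorization_le_iff_dvd (hPart_ne_zero h n) hn]
  intro p
  rw [factorization_hPart]
  split_ifs
  · exact le_rfl
  · exact Nat.zero_le _

/-- The `h`-part is supported on the primes of `h`. [folklore] -/
theorem primeFactors_hPart_subset (h n : ℕ) :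
    (∏ q ∈ h.primeFactors, q ^ n.factorization q).primeFactors ⊆ h.primeFactors := by
  intro p hp
  have h1 : 0 < (∏ q ∈ h.primeFactors, q ^ n.factorization q).factorization p :=
    (Nat.prime_of_mem_primeFactors hp).factorization_pos_of_dvd (hPart_ne_zero h n)
      (Nat.dvd_of_mem_primeFactors hp)
  rw [factorization_hPart] at h1
  by_contra hne
  rw [if_neg hne] at h1
  exact lt_irrefl 0 h1

/-- The cofactor of the `h`-part is coprime to `h` (`n, h ≠ 0`). [folklore] -/
theorem coprime_div_hPart {n h : ℕ} (hn : n ≠ 0) (hh : h ≠ 0) :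
    (n / ∏ q ∈ h.primeFactors, q ^ n.factorization q).Coprime h := by
  refine Nat.coprime_of_dvd fun p hp hpd hph => ?_
  have hdiv := hPart_dvd hn h
  have hq0 : n / ∏ q ∈ h.primeFactors, q ^ n.factorization q ≠ 0 :=
    (Nat.div_ne_zero_iff_of_dvd hdiv).mpr ⟨hn, hPart_ne_zero h n⟩
  have h1 : 0 < (n / ∏ q ∈ h.primeFactors, q ^ n.factorization q).factorization p :=
    hp.factorization_pos_of_dvd hq0 hpd
  rw [Nat.factorization_div hdiv, Finsupp.tsub_apply, factorization_hPart,
    if_pos (Nat.mem_primeFactors.mpr ⟨hp, hph, hh⟩), Nat.sub_self] at h1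
  exact lt_irrefl 0 h1

/-- The `h`-part and its cofactor are coprime (`n, h ≠ 0`). [folklore] -/
theorem coprime_hPart_div {n h : ℕ} (hn : n ≠ 0) (hh : h ≠ 0) :
    (∏ q ∈ h.primeFactors, q ^ n.factorization q).Coprime
      (n / ∏ q ∈ h.primeFactors, q ^ n.factorization q) := by
  refine Nat.coprime_of_dvd fun p hp hpe hpu => ?_
  have hph : p ∣ h := Nat.dvd_of_mem_primeFactors
    (primeFactors_hPart_subset h n (Nat.mem_primeFactors.mpr ⟨hp, hpe, hPart_ne_zero h n⟩))
  have hcop := coprime_div_hPart hn hh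
  have := Nat.dvd_gcd hpu hph
  rw [hcop.gcd_eq_one] at this
  exact hp.one_lt.ne' (Nat.dvd_one.mp this)

/-- `hPart · (n / hPart) = n`. [folklore] -/
theorem hPart_mul_div {n : ℕ} (hn : n ≠ 0) (h : ℕ) :
    (∏ q ∈ h.primeFactors, q ^ n.factorization q) * (n / ∏ q ∈ h.primeFactors, q ^ n.factorization q) = n :=
  Nat.mul_div_cancel' (hPart_dvd hn h)

/-- An `h`-supported divisor of `n` divides the `h`-part of `n`. [folklore] -/
theorem dvd_hPart_of_dvd {d n h : ℕ} (hn : n ≠ 0) (hd : d ∣ n) (hsupp : d.primeFactors ⊆ h.primeFactors) :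
    d ∣ ∏ q ∈ h.primeFactors, q ^ n.factorization q := by
  have hd0 : d ≠ 0 := fun h0 => hn (Nat.eq_zero_of_zero_dvd (h0 ▸ hd))
  rw [← Nat.factorization_le_iff_dvd hd0 (hPart_ne_zero h n)]
  intro p
  rw [factorization_hPart]
  split_ifs with hp
  · exact (Nat.factorization_le_iff_dvd hd0 hn).mpr hd p
  · rw [Nat.le_zero, ← Finsupp.notMem_support_iff, Nat.support_factorization]
    exact fun h' => hp (hsupp h')

/-- The `h`-part of a product of coprime-to-`h`... : if `u` is coprime to `h` then the `h`-part of
`e u` is the `h`-part of `e` (`e, u ≠ 0`). [folklore] -/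
theorem hPart_mul_of_coprime {e u h : ℕ} (he : e ≠ 0) (hu : u ≠ 0) (hcop : u.Coprime h) :
    ∏ q ∈ h.primeFactors, q ^ (e * u).factorization q = ∏ q ∈ h.primeFactors, q ^ e.factorization q := by
  refine Finset.prod_congr rfl fun q hq => ?_
  congr 1
  rw [Nat.factorization_mul he hu, Finsupp.add_apply]
  have : u.factorization q = 0 := by
    refine Nat.factorization_eq_zero_of_not_dvd fun hqu => ?_
    have hqq := Nat.prime_of_mem_primeFactors hq
    have := Nat.dvd_gcd hqu (Nat.dvd_of_mem_primeFactors hq)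
    rw [hcop.gcd_eq_one] at this
    exact hqq.one_lt.ne' (Nat.dvd_one.mp this)
  rw [this, add_zero]

/-- If all prime factors of `n ≠ 0` lie among those of `h`, the `h`-part of `n` is `n`. [folklore] -/
theorem hPart_eq_self {n h : ℕ} (hn : n ≠ 0) (hsupp : n.primeFactors ⊆ h.primeFactors) :
    ∏ q ∈ h.primeFactors, q ^ n.factorization q = n := by
  refine Nat.eq_of_factorization_eq (hPart_ne_zero h n) hn fun p => ?_
  rw [factorization_hPart]
  split_ifs with hp
  · rfl
  · symm
    rw [← Finsupp.notMem_support_iff, Nat.support_factorization]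
    exact fun h' => hp (hsupp h')


/-! ### Counting multiples -/

/-- `#{1 ≤ n ≤ N : d ∣ n} ≤ N/d`. [folklore] -/
theorem card_multiples_le (N : ℕ) {d : ℕ} (hd : 0 < d) :
    (#((Icc 1 N).filter fun n : ℕ => d ∣ n) : ℝ) ≤ (N : ℝ) / d := by
  have hIcc : (Icc 1 N : Finset ℕ) = Ioc 0 N := by
    ext n; simp only [Finset.mem_Icc, Finset.mem_Ioc]; omega
  rw [hIcc, Nat.Ioc_filter_dvd_card_eq_div, le_div_iff₀ (by exact_mod_cast hd)]
  exact_mod_cast Nat.div_mul_le_self N d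

/-- A solvable linear congruence `a·r + b ≡ 0 (mod q)` with `(a, q) = 1`, `q ≥ 1`, has a solution
`1 ≤ r ≤ q`, and every solution is congruent to it. [folklore] -/
theorem exists_rep {a b q : ℕ} (hq : 1 ≤ q) (haq : a.Coprime q) :
    ∃ r : ℕ, 1 ≤ r ∧ r ≤ q ∧ q ∣ a * r + b ∧ ∀ d : ℕ, q ∣ a * d + b → d ≡ r [MOD q] := by
  haveI : NeZero q := ⟨by omega⟩
  -- the solution modulo `q`
  have hunit : IsUnit (a : ZMod q) := (ZMod.isUnit_iff_coprime a q).mpr haq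
  set u : ZMod q := -(b : ZMod q) * (hunit.unit⁻¹ : (ZMod q)ˣ) with hu
  have hsol : (a : ZMod q) * u + b = 0 := by
    calc (a : ZMod q) * u + b
        = -(b : ZMod q) * ((a : ZMod q) * (hunit.unit⁻¹ : (ZMod q)ˣ)) + b := by rw [hu]; ring
      _ = 0 := by rw [hunit.mul_val_inv]; ring
  -- representative in `[1, q]`
  set r₀ : ℕ := u.val with hr₀
  refine ⟨if r₀ = 0 then q else r₀, ?_, ?_, ?_, ?_⟩
  · split_ifs with h
    · exact hq
    · exact Nat.pos_of_ne_zero h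
  · split_ifs with h
    · exact le_rfl
    · exact (ZMod.val_lt u).le
  · have hcast : ((if r₀ = 0 then q else r₀ : ℕ) : ZMod q) = u := by
      split_ifs with h
      · rw [ZMod.natCast_self]
        rw [hr₀, ZMod.val_eq_zero] at h
        exact h.symm
      · rw [hr₀, ZMod.natCast_zmod_val]
    rw [← ZMod.natCast_eq_zero_iff]
    have : ((a * (if r₀ = 0 then q else r₀) + b : ℕ) : ZMod q) =
        (a : ZMod q) * ((if r₀ = 0 then q else r₀ : ℕ) : ZMod q) + b := by push_cast; ring
    rw [this, hcast]
    exact hsol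
  · intro d hd
    rw [← ZMod.natCast_eq_zero_iff] at hd
    push_cast at hd
    -- `a d + b = 0 = a u + b` in `ZMod q`, and `a` is a unit
    have hdu : (d : ZMod q) = u := by
      have h1 : (a : ZMod q) * d = (a : ZMod q) * u := by
        have := hsol; linear_combination hd - this
      exact (hunit.mul_right_injective h1)
    rw [Nat.ModEq, ← ZMod.natCast_eq_natCast_iff']
    rw [hdu]
    split_ifs with h
    · rw [ZMod.natCast_self]
      rw [hr₀, ZMod.val_eq_zero] at h
      exact h
    · rw [hr₀, ZMod.natCast_zmod_val]


/-- `#{1 ≤ n ≤ N : d ∣ mn + h} ≤ N/d + 1` when `(d, m) = 1` (the solutions form one residue class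
modulo `d`). [folklore] -/
theorem card_lin_multiples_le (N m h : ℕ) {d : ℕ} (hd : 0 < d) (hdm : d.Coprime m) :
    (#((Icc 1 N).filter fun n : ℕ => d ∣ m * n + h) : ℝ) ≤ (N : ℝ) / d + 1 := by
  obtain ⟨r, -, -, -, hrall⟩ := exists_rep (b := h) hd hdm.symm
  have hsub : ((Icc 1 N).filter fun n : ℕ => d ∣ m * n + h) ⊆
      (Ioc 0 N).filter fun n : ℕ => n ≡ r [MOD d] := by
    intro n hn
    rw [Finset.mem_filter, Finset.mem_Icc] at hn
    rw [Finset.mem_filter, Finset.mem_Ioc]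
    exact ⟨by omega, hrall n hn.2⟩
  calc (#((Icc 1 N).filter fun n : ℕ => d ∣ m * n + h) : ℝ)
      ≤ #((Ioc 0 N).filter fun n : ℕ => n ≡ r [MOD d]) := by exact_mod_cast Finset.card_le_card hsub
    _ ≤ ((N : ℝ) - (0 : ℕ)) / d + 1 := Shiu.card_segment_modEq_le hd r (Nat.zero_le N)
    _ = (N : ℝ) / d + 1 := by simp


/-! ### Integers with a large `h`-part are rare -/

/-- **Reciprocal square roots of `h`-supported numbers.** For a finite set `S` of positive integers
supported on the primes of `h`: `∑_{t ∈ S} 1/√t ≤ 4^{ω(h)}`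
(Euler product, `∑_a p^{-a/2} = (1 − p^{-1/2})⁻¹ ≤ 4`). [folklore] -/
theorem sum_inv_sqrt_le_four_pow (h : ℕ) {S : Finset ℕ}
    (hS : ∀ t ∈ S, t ≠ 0 ∧ t.primeFactors ⊆ h.primeFactors) :
    ∑ t ∈ S, 1 / Real.sqrt t ≤ (4 : ℝ) ^ #h.primeFactors := by
  set g : ℕ → ℝ := fun t => 1 / Real.sqrt t with hg
  have hg1 : g 1 = 1 := by simp [hg]
  have hgmul : ∀ {a b : ℕ}, Nat.Coprime a b → g (a * b) = g a * g b := by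
    intro a b _
    simp only [hg, Nat.cast_mul]
    rw [Real.sqrt_mul (Nat.cast_nonneg a), one_div_mul_one_div]
  have hg0 : ∀ n, 0 ≤ g n := fun n => by simp only [hg]; positivity
  have hgpow : ∀ p a : ℕ, g (p ^ a) = (1 / Real.sqrt p) ^ a := by
    intro p a
    simp only [hg, Nat.cast_pow]
    rw [Real.sqrt_eq_rpow, Real.sqrt_eq_rpow, Shiu.rpow_pow_comm, one_div_pow]
  have hratio : ∀ {p : ℕ}, p.Prime → 0 ≤ 1 / Real.sqrt p ∧ 1 / Real.sqrt p ≤ 3 / 4 := by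
    intro p hp
    refine ⟨by positivity, ?_⟩
    have hp2 : (2 : ℝ) ≤ p := by exact_mod_cast hp.two_le
    have hs : Real.sqrt 2 ≤ Real.sqrt p := Real.sqrt_le_sqrt hp2
    have h2 : (4 / 3 : ℝ) ≤ Real.sqrt 2 := by
      rw [show (4 / 3 : ℝ) = Real.sqrt ((4 / 3) ^ 2) by rw [Real.sqrt_sq (by norm_num)]]
      exact Real.sqrt_le_sqrt (by norm_num)
    rw [div_le_iff₀ (by linarith), ← div_le_iff₀' (by norm_num)]
    linarith
  have hsum : ∀ {p : ℕ}, p.Prime → Summable (fun a : ℕ => g (p ^ a)) := by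
    intro p hp
    simp_rw [hgpow p]
    obtain ⟨h0, h34⟩ := hratio hp
    exact summable_geometric_of_lt_one h0 (by linarith)
  have hD : ∀ t ∈ S, t ∈ Nat.factoredNumbers h.primeFactors := by
    intro t ht
    obtain ⟨ht0, hsub⟩ := hS t ht
    rw [Nat.mem_factoredNumbers']
    intro p hp hpt
    exact hsub (Nat.mem_primeFactors.mpr ⟨hp, hpt, ht0⟩)
  have hmain := BombieriSieve.sum_le_prod_tsum_of_factored hg1 hgmul hg0 hsum
    (s := h.primeFactors) (fun p hp => Nat.prime_of_mem_primeFactors hp) hD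
  refine hmain.trans ?_
  rw [← Finset.prod_const]
  refine Finset.prod_le_prod (fun p _ => tsum_nonneg fun a => hg0 _) fun p hp => ?_
  have hpp := Nat.prime_of_mem_primeFactors hp
  obtain ⟨h0, h34⟩ := hratio hpp
  simp_rw [hgpow p]
  rw [tsum_geometric_of_lt_one h0 (by linarith)]
  rw [inv_le_comm₀ (by linarith) (by norm_num)]
  linarith

/-- **Integers with a large `h`-part.** For `Y ≥ 1`:
`#{1 ≤ n ≤ N : hPart_h(n) > Y} ≤ (N/√Y) 4^{ω(h)}`. [folklore] -/
theorem card_hPart_gt_le (N h : ℕ) {Y : ℝ} (hY : 1 ≤ Y) :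
    (#((Icc 1 N).filter fun n : ℕ => Y < ((∏ q ∈ h.primeFactors, q ^ n.factorization q : ℕ) : ℝ)) : ℝ) ≤
      (N : ℝ) / Real.sqrt Y * (4 : ℝ) ^ #h.primeFactors := by
  set A := (Icc 1 N).filter fun n : ℕ => Y < ((∏ q ∈ h.primeFactors, q ^ n.factorization q : ℕ) : ℝ)
    with hA
  set T := (Icc 1 N).filter fun t : ℕ => t.primeFactors ⊆ h.primeFactors ∧ Y < (t : ℝ) with hT
  set tp : ℕ → ℕ := fun n => ∏ q ∈ h.primeFactors, q ^ n.factorization q with htp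
  have hmaps : ∀ n ∈ A, tp n ∈ T := by
    intro n hn
    rw [hA, Finset.mem_filter, Finset.mem_Icc] at hn
    have hn0 : n ≠ 0 := by omega
    rw [hT, Finset.mem_filter, Finset.mem_Icc]
    refine ⟨⟨Nat.one_le_iff_ne_zero.mpr (hPart_ne_zero h n), ?_⟩, primeFactors_hPart_subset h n, hn.2⟩
    exact (Nat.le_of_dvd (by omega) (hPart_dvd hn0 h)).trans hn.1.2
  have hsqY : 0 < Real.sqrt Y := Real.sqrt_pos.mpr (by linarith)
  rw [Finset.card_eq_sum_card_fiberwise hmaps]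
  push_cast
  -- each fibre consists of multiples of `t`
  have hfib : ∀ t ∈ T, (#(A.filter fun n => tp n = t) : ℝ) ≤ (N : ℝ) / Real.sqrt Y * (1 / Real.sqrt t) := by
    intro t ht
    rw [hT, Finset.mem_filter, Finset.mem_Icc] at ht
    obtain ⟨⟨ht1, -⟩, -, hYt⟩ := ht
    have ht0 : (0 : ℝ) < t := by exact_mod_cast ht1
    have hsub : A.filter (fun n => tp n = t) ⊆ (Icc 1 N).filter fun n : ℕ => t ∣ n := by
      intro n hn
      rw [Finset.mem_filter] at hn
      obtain ⟨hnA, hnt⟩ := hn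
      rw [hA, Finset.mem_filter] at hnA
      rw [Finset.mem_filter]
      refine ⟨hnA.1, ?_⟩
      rw [← hnt]
      exact hPart_dvd (by have := (Finset.mem_Icc.mp hnA.1).1; omega) h
    calc (#(A.filter fun n => tp n = t) : ℝ) ≤ #((Icc 1 N).filter fun n : ℕ => t ∣ n) := by
          exact_mod_cast Finset.card_le_card hsub
      _ ≤ (N : ℝ) / t := card_multiples_le N ht1
      _ ≤ (N : ℝ) / Real.sqrt Y * (1 / Real.sqrt t) := by
          rw [mul_one_div, div_div]
          refine div_le_div_of_nonneg_left (Nat.cast_nonneg N) (by positivity) ?_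
          -- `√Y √t ≤ t`
          have h1 : Real.sqrt Y ≤ Real.sqrt t := Real.sqrt_le_sqrt hYt.le
          have h2 : Real.sqrt t * Real.sqrt t = t := Real.mul_self_sqrt ht0.le
          nlinarith [Real.sqrt_nonneg (t : ℝ)]
  have hTsupp : ∀ t ∈ T, t ≠ 0 ∧ t.primeFactors ⊆ h.primeFactors := by
    intro t ht
    rw [hT, Finset.mem_filter, Finset.mem_Icc] at ht
    exact ⟨by omega, ht.2.1⟩
  calc ∑ t ∈ T, (#(A.filter fun n => tp n = t) : ℝ)
      ≤ ∑ t ∈ T, (N : ℝ) / Real.sqrt Y * (1 / Real.sqrt t) := Finset.sum_le_sum hfib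
    _ = (N : ℝ) / Real.sqrt Y * ∑ t ∈ T, 1 / Real.sqrt t := by rw [Finset.mul_sum]
    _ ≤ (N : ℝ) / Real.sqrt Y * (4 : ℝ) ^ #h.primeFactors :=
        mul_le_mul_of_nonneg_left (sum_inv_sqrt_le_four_pow h hTsupp) (by positivity)


/-- A number `s > Y` all of whose prime factors are `≤ Y` has a divisor in `(Y, Y²]`
(`Y ≥ 1`). [folklore] -/
theorem exists_dvd_Ioc {Y : ℝ} (hY : 1 ≤ Y) :
    ∀ s : ℕ, Y < s → (∀ p ∈ s.primeFactors, (p : ℝ) ≤ Y) → ∃ d : ℕ, d ∣ s ∧ Y < d ∧ (d : ℝ) ≤ Y ^ 2 := by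
  intro s
  induction s using Nat.strong_induction_on with
  | _ s ih =>
    intro hsY hsmooth
    by_cases hle : (s : ℝ) ≤ Y ^ 2
    · exact ⟨s, dvd_refl s, hsY, hle⟩
    · push Not at hle
      have hs2 : 2 ≤ s := by
        have : (1 : ℝ) < s := lt_of_le_of_lt hY hsY
        exact_mod_cast this
      set p := s.minFac with hp
      have hpp : p.Prime := Nat.minFac_prime (by omega)
      have hps : p ∣ s := Nat.minFac_dvd s
      have hpY : (p : ℝ) ≤ Y := hsmooth p (Nat.mem_primeFactors.mpr ⟨hpp, hps, by omega⟩)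
      have hp1 : (1 : ℝ) ≤ p := by exact_mod_cast hpp.one_lt.le
      obtain ⟨s', hs'⟩ := hps
      have hs'0 : s' ≠ 0 := by rintro rfl; rw [mul_zero] at hs'; omega
      have hs'lt : s' < s := by
        rw [hs']
        exact lt_mul_of_one_lt_left (Nat.pos_of_ne_zero hs'0) hpp.one_lt
      have hYs' : Y < s' := by
        -- `p s' = s > Y²` and `p ≤ Y`
        have hcast : (s : ℝ) = p * s' := by rw [hs']; push_cast; ring
        rw [hcast] at hle
        by_contra hge
        push Not at hge
        have : (p : ℝ) * s' ≤ Y * Y := mul_le_mul hpY hge (Nat.cast_nonneg _) (by linarith)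
        nlinarith
      have hsmooth' : ∀ q ∈ s'.primeFactors, (q : ℝ) ≤ Y := fun q hq =>
        hsmooth q (Nat.primeFactors_mono ⟨p, by rw [hs']; ring⟩ (by omega) hq)
      obtain ⟨d, hd, hYd, hdY⟩ := ih s' hs'lt hYs' hsmooth'
      exact ⟨d, hd.trans ⟨p, by rw [hs']; ring⟩, hYd, hdY⟩

/-- **Integers `n` for which `mn + h` has a large `h`-part** (`h ≠ 0`, `(m, h) = 1`, `Y ≥ 1`):
`#{1 ≤ n ≤ N : hPart_h(mn + h) > Y} ≤ 2 (N/√Y) 4^{ω(h)} + Y²`. [folklore] -/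
theorem card_hPart_lin_gt_le (N m : ℕ) {h : ℕ} (hh : h ≠ 0) (hmh : m.Coprime h) {Y : ℝ} (hY : 1 ≤ Y) :
    (#((Icc 1 N).filter fun n : ℕ =>
        Y < ((∏ q ∈ h.primeFactors, q ^ (m * n + h).factorization q : ℕ) : ℝ)) : ℝ) ≤
      2 * ((N : ℝ) / Real.sqrt Y * (4 : ℝ) ^ #h.primeFactors) + Y ^ 2 := by
  set S := (Icc 1 N).filter fun n : ℕ =>
    Y < ((∏ q ∈ h.primeFactors, q ^ (m * n + h).factorization q : ℕ) : ℝ) with hS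
  -- the two covering families
  set Pbig := h.primeFactors.filter fun p : ℕ => Y < (p : ℝ) with hPbig
  set D := (Icc 1 ⌊Y ^ 2⌋₊).filter fun d : ℕ => d.primeFactors ⊆ h.primeFactors ∧ Y < (d : ℝ) with hD
  set A := Pbig.biUnion fun p => (Icc 1 N).filter fun n : ℕ => p ∣ n with hA
  set B := D.biUnion fun d => (Icc 1 N).filter fun n : ℕ => d ∣ m * n + h with hB
  have hcover : S ⊆ A ∪ B := by
    intro n hn
    rw [hS, Finset.mem_filter] at hn
    obtain ⟨hnI, hYs⟩ := hn
    set sv := ∏ q ∈ h.primeFactors, q ^ (m * n + h).factorization q with hsv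
    have hL0 : m * n + h ≠ 0 := by omega
    rw [Finset.mem_union]
    by_cases hbig : ∃ p ∈ sv.primeFactors, Y < (p : ℝ)
    · left
      obtain ⟨p, hp, hYp⟩ := hbig
      have hph : p ∈ h.primeFactors := primeFactors_hPart_subset h _ hp
      have hpp := Nat.prime_of_mem_primeFactors hph
      have hpL : p ∣ m * n + h := (Nat.dvd_of_mem_primeFactors hp).trans (hPart_dvd hL0 h)
      have hpm : ¬ p ∣ m := fun hpm => by
        have := Nat.dvd_gcd hpm (Nat.dvd_of_mem_primeFactors hph)
        rw [hmh.gcd_eq_one] at this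
        exact hpp.one_lt.ne' (Nat.dvd_one.mp this)
      have hpn : p ∣ n := (dvd_iff_dvd_lin hpp (Nat.dvd_of_mem_primeFactors hph) hpm n).mpr hpL
      rw [hA, Finset.mem_biUnion]
      exact ⟨p, Finset.mem_filter.mpr ⟨hph, hYp⟩, Finset.mem_filter.mpr ⟨hnI, hpn⟩⟩
    · right
      push Not at hbig
      obtain ⟨d, hdsv, hYd, hdY⟩ := exists_dvd_Ioc hY sv hYs hbig
      have hd0 : d ≠ 0 := fun h0 => hPart_ne_zero h _ (Nat.eq_zero_of_zero_dvd (h0 ▸ hdsv))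
      rw [hB, Finset.mem_biUnion]
      refine ⟨d, ?_, Finset.mem_filter.mpr ⟨hnI, hdsv.trans (hPart_dvd hL0 h)⟩⟩
      rw [hD, Finset.mem_filter, Finset.mem_Icc]
      refine ⟨⟨Nat.one_le_iff_ne_zero.mpr hd0, Nat.le_floor hdY⟩, ?_, hYd⟩
      exact (Nat.primeFactors_mono hdsv (hPart_ne_zero h _)).trans (primeFactors_hPart_subset h _)
  have hsqY : 0 < Real.sqrt Y := Real.sqrt_pos.mpr (by linarith)
  have hsqY1 : Real.sqrt Y ≤ Y := by
    have h1 : Real.sqrt Y * Real.sqrt Y = Y := Real.mul_self_sqrt (by linarith)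
    have h2 : 1 ≤ Real.sqrt Y := by rw [← Real.sqrt_one]; exact Real.sqrt_le_sqrt hY
    nlinarith
  -- the big primes
  have hAcard : (#A : ℝ) ≤ (N : ℝ) / Real.sqrt Y * (4 : ℝ) ^ #h.primeFactors := by
    have h1 : (#A : ℝ) ≤ ∑ p ∈ Pbig, (#((Icc 1 N).filter fun n : ℕ => p ∣ n) : ℝ) := by
      rw [hA]; exact_mod_cast Finset.card_biUnion_le
    refine h1.trans ?_
    have h2 : ∀ p ∈ Pbig, (#((Icc 1 N).filter fun n : ℕ => p ∣ n) : ℝ) ≤ (N : ℝ) / Real.sqrt Y := by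
      intro p hp
      rw [hPbig, Finset.mem_filter] at hp
      have hpp := Nat.prime_of_mem_primeFactors hp.1
      refine (card_multiples_le N hpp.pos).trans ?_
      exact div_le_div_of_nonneg_left (Nat.cast_nonneg N) hsqY (hsqY1.trans hp.2.le)
    refine (Finset.sum_le_sum h2).trans ?_
    rw [Finset.sum_const, nsmul_eq_mul]
    have h3 : (#Pbig : ℝ) ≤ (4 : ℝ) ^ #h.primeFactors := by
      calc (#Pbig : ℝ) ≤ #h.primeFactors := by
            rw [hPbig]; exact_mod_cast Finset.card_filter_le _ _
        _ ≤ (4 : ℝ) ^ #h.primeFactors := by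
            have := one_add_mul_le_pow (show (-2 : ℝ) ≤ 3 by norm_num) #h.primeFactors
            norm_num at this
            linarith
    calc (#Pbig : ℝ) * ((N : ℝ) / Real.sqrt Y) ≤ (4 : ℝ) ^ #h.primeFactors * ((N : ℝ) / Real.sqrt Y) :=
          mul_le_mul_of_nonneg_right h3 (by positivity)
      _ = _ := by ring
  -- the divisors in `(Y, Y²]`
  have hBcard : (#B : ℝ) ≤ (N : ℝ) / Real.sqrt Y * (4 : ℝ) ^ #h.primeFactors + Y ^ 2 := by
    have h1 : (#B : ℝ) ≤ ∑ d ∈ D, (#((Icc 1 N).filter fun n : ℕ => d ∣ m * n + h) : ℝ) := by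
      rw [hB]; exact_mod_cast Finset.card_biUnion_le
    refine h1.trans ?_
    have hDmem : ∀ d ∈ D, (1 ≤ d ∧ d ≤ ⌊Y ^ 2⌋₊) ∧ d.primeFactors ⊆ h.primeFactors ∧ Y < (d : ℝ) := by
      intro d hd
      rw [hD, Finset.mem_filter, Finset.mem_Icc] at hd
      exact hd
    have h2 : ∀ d ∈ D, (#((Icc 1 N).filter fun n : ℕ => d ∣ m * n + h) : ℝ) ≤
        (N : ℝ) / Real.sqrt Y * (1 / Real.sqrt d) + 1 := by
      intro d hd
      obtain ⟨⟨hd1, -⟩, hsupp, hYd⟩ := hDmem d hd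
      have hdm : d.Coprime m := by
        refine Nat.coprime_of_dvd fun p hp hpd hpm => ?_
        have hph : p ∣ h := Nat.dvd_of_mem_primeFactors (hsupp (Nat.mem_primeFactors.mpr ⟨hp, hpd, by omega⟩))
        have := Nat.dvd_gcd hpm hph
        rw [hmh.gcd_eq_one] at this
        exact hp.one_lt.ne' (Nat.dvd_one.mp this)
      refine (card_lin_multiples_le N m h hd1 hdm).trans (add_le_add ?_ le_rfl)
      have hd0 : (0 : ℝ) < d := by exact_mod_cast hd1
      rw [mul_one_div, div_div]
      refine div_le_div_of_nonneg_left (Nat.cast_nonneg N) (by positivity) ?_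
      have e1 : Real.sqrt Y ≤ Real.sqrt d := Real.sqrt_le_sqrt hYd.le
      have e2 : Real.sqrt d * Real.sqrt d = d := Real.mul_self_sqrt hd0.le
      nlinarith [Real.sqrt_nonneg (d : ℝ)]
    refine (Finset.sum_le_sum h2).trans ?_
    rw [Finset.sum_add_distrib, Finset.sum_const, nsmul_eq_mul, mul_one, ← Finset.mul_sum]
    have hDsupp : ∀ d ∈ D, d ≠ 0 ∧ d.primeFactors ⊆ h.primeFactors := fun d hd =>
      ⟨by have := (hDmem d hd).1.1; omega, (hDmem d hd).2.1⟩
    have h3 := sum_inv_sqrt_le_four_pow h hDsupp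
    have h4 : (#D : ℝ) ≤ Y ^ 2 := by
      calc (#D : ℝ) ≤ #(Icc 1 ⌊Y ^ 2⌋₊) := by rw [hD]; exact_mod_cast Finset.card_filter_le _ _
        _ = ⌊Y ^ 2⌋₊ := by simp
        _ ≤ Y ^ 2 := Nat.floor_le (by positivity)
    have := mul_le_mul_of_nonneg_left h3 (show 0 ≤ (N : ℝ) / Real.sqrt Y by positivity)
    linarith
  calc (#S : ℝ) ≤ #(A ∪ B) := by exact_mod_cast Finset.card_le_card hcover
    _ ≤ #A + #B := by exact_mod_cast Finset.card_union_le A B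
    _ ≤ _ := by linarith

end PairShiu

end Literature.NumberTheory.Sieve
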